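import Literature.NumberTheory.GelbartRogawski1991.Prop311PrintedFormRescaling
import HarnessLib

/-!
# [GelbartRogawski1991, Prop. 3.1.1] AS PRINTED: rescaling the form, II — `Mp_𝐀(W)` and the printed conclusion

Topic `NumberTheory/GelbartRogawski1991`; namespace `Literature.NumberTheory.GelbartRogawski1991.Prop311`.  KERNEL ONLY:
theorems; no definition, no named fact, no `sorry`; `Prop311AsPrinted` is untouched.  Continuation of
`Prop311PrintedFormRescaling` (`ξ ∈ Fˣ`, data `(V, Φ)` and `(V, ξΦ)`, `τ_ξ : H_𝐀(W, ½ξφ) → H_𝐀(W, ½φ)`, `(w, t) ↦ (w, ξ⁻¹ t)`):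

* §6 **`exists_mulEquiv_adelicMp_smul`**: for any isomorphism `τ : H_𝐀(W, ½ξφ) → H_𝐀(W, ½φ)` onto and compatible with
  Weil's actions of `Sp_𝐀(W)`, print's groups of bounded pairs `Mp_𝐀(W)` ([GelbartRogawski1991, §3.1 p. 454 L21–27]) over
  `ρ ∘ τ` (data `(V, ξΦ)`) and over `ρ` (data `(V, Φ)`) are identified by `(g, M) ↦ (g, M)` — a group isomorphism over
  `Sp_𝐀(W)`, with the same operators, bicontinuous for rendering R2 of `Prop311AsPrinted`;
* §7 rational splittings go over in both directions (`isRationalSplitting_of_smul`, `isRationalSplitting_smul_of`), and so do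
  clauses (1) ∧ (2) of Prop. 3.1.1 verbatim (`conclusion_transport_smul`: along the identification, the equality `G(𝐀) = G(𝐀)`
  — continuous for the printed topologies, rational points to rational points — and `Sp_F(W) = Sp_F(W)`);
* §8 for the concrete `τ_ξ`: **`conclusion_of_conclusion_smul`** — clauses (1) ∧ (2) for `(V, ξΦ, ρ ∘ τ_ξ)` and SOME rational
  splitting give them for `(V, Φ, ρ)` and THE rational splitting `i`; `exists_isRationalSplitting_smul` (binder `_hi` for the
  rescaled model); the companion's `comp_heisTwist_printed_binders` supplies the binders `_hρu _hρc _hρi _hρz` of the rescaled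
  model (central character `ψ₀` when `ψ = ψ₀(ξ ·)` — Tate: every `ψ` is `ψ_F(ξ ·)`, [CasselsFrohlichANT1967, Ch. XV Thm 4.1.4]).

So the printed proposition for `(V, Φ)` and an arbitrary `ψ` follows from the printed proposition for `(V, ξΦ)` and `ψ_F`
together with `Prop311ModelIndependence.conclusion_of_conclusion` (which moves the conclusion between printed models with
the same central character).  Bookkeeping only; kernel-safety note: the two families of objects are never compared by
definitional unfolding — every identification goes through `MulEquiv.subgroupCongr` of a proved equality of subgroups.

## References
* [GelbartRogawski1991] S. Gelbart, J. Rogawski, Invent. Math. 105 (1991) 445–472, §3.1 p. 454 L17–42, Prop. 3.1.1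
  p. 455 L1–2.
* [Weil1964] A. Weil, Acta Math. 111 (1964) 143–211, Chap. I n° 3–5 pp. 149–151.
* [MoeglinVignerasWaldspurger1987] C. Mœglin, M.-F. Vignéras, J.-L. Waldspurger, LNM 1291 (1987), Chap. 2 I.1–I.2, II.1.
* [CasselsFrohlichANT1967] J. W. S. Cassels, A. Fröhlich (eds.), Algebraic Number Theory (1967), Ch. XV (Tate) Thm 4.1.4.
-/

set_option autoImplicit false

noncomputable section

open NumberField
open scoped TensorProduct
open Literature.RepresentationTheory.HeisenbergGroup

namespace Literature.NumberTheory.GelbartRogawski1991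

namespace Prop311

variable (F : Type) [Field F] [NumberField F]
variable (E : Type) [Field E] [Algebra F E]
variable (V : Type) [AddCommGroup V] [Module F V]
variable (Φ : V →ₗ[F] V →ₗ[F] E) {ξ : F} (hξ : ξ ≠ 0)

/-! ## §6 Print's `Mp_𝐀(W)` over the two models: `(g, M) ↦ (g, M)` -/

section Mp

variable {F E V Φ}
variable (τ : AdelicHeisenberg F E V (ξ • Φ) →* AdelicHeisenberg F E V Φ) (hτs : Function.Surjective τ)
  (hτa : ∀ (g : AdelicSpace F V ≃ₗ[AdeleRing (𝓞 F) F] AdelicSpace F V) (hg : g ∈ adelicSp F E V Φ)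
    (hg' : g ∈ adelicSp F E V (ξ • Φ)) (h : AdelicHeisenberg F E V (ξ • Φ)),
    τ ((ofSymplectic (heisForm F E V (ξ • Φ)) ⟨g, hg'⟩).act h) = (ofSymplectic (heisForm F E V Φ) ⟨g, hg⟩).act (τ h))
variable {S : Type} [NormedAddCommGroup S] [InnerProductSpace ℂ S]
variable (ρ : Representation ℂ (AdelicHeisenberg F E V Φ) S)

omit hξ in
/-- `π` and `ω_ψ` read on the pair (unfolding `proj`, `projEnd`, `op`). [cite: GelbartRogawski1991, §3.1 p. 454 L24–25] -/
theorem projEnd_eq_coe (Φ' : V →ₗ[F] V →ₗ[F] E) (ρ₁ : Representation ℂ (AdelicHeisenberg F E V Φ') S)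
    (p : adelicMp F E V Φ' ρ₁) :
    projEnd F E V Φ' ρ₁ p =
      (((p : adelicSp F E V Φ' × (S ≃ₗ[ℂ] S)).1 : AdelicSpace F V ≃ₗ[AdeleRing (𝓞 F) F] AdelicSpace F V) :
        AdelicSpace F V →ₗ[AdeleRing (𝓞 F) F] AdelicSpace F V) := rfl

omit hξ in
/-- `ω_ψ(p) = M_p`, the second component. [cite: GelbartRogawski1991, §3.1 p. 454 L24–25] -/
theorem op_eq_snd (Φ' : V →ₗ[F] V →ₗ[F] E) (ρ₁ : Representation ℂ (AdelicHeisenberg F E V Φ') S)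
    (p : adelicMp F E V Φ' ρ₁) : op F E V Φ' ρ₁ p = (p : adelicSp F E V Φ' × (S ≃ₗ[ℂ] S)).2 := rfl

include hτs hτa in
/-- **membership is the same**: for `g ∈ Sp_𝐀(W)` and an operator `M`, `(g, M)` is a bounded pair of `Mp_𝐀(W)` over `ρ ∘ τ`
(data `(V, ξΦ)`) iff it is one over `ρ` (data `(V, Φ)`) — relation (A) transported by `hτa`.
[cite: GelbartRogawski1991, §3.1 p. 454 L21–24; MoeglinVignerasWaldspurger1987, Chap. 2 II.1 (A)] -/
theorem mem_adelicMp_smul_iff (g : AdelicSpace F V ≃ₗ[AdeleRing (𝓞 F) F] AdelicSpace F V) (hg : g ∈ adelicSp F E V Φ)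
    (hg' : g ∈ adelicSp F E V (ξ • Φ)) (M : S ≃ₗ[ℂ] S) :
    ((⟨g, hg'⟩ : adelicSp F E V (ξ • Φ)), M) ∈ adelicMp F E V (ξ • Φ) (ρ.comp τ) ↔
      ((⟨g, hg⟩ : adelicSp F E V Φ), M) ∈ adelicMp F E V Φ ρ := by
  rw [adelicMp, adelicMp, Subgroup.mem_inf, Subgroup.mem_inf, Subgroup.mem_comap, Subgroup.mem_comap,
    MonoidHom.coe_snd, MonoidHom.coe_snd, mem_MpPsi, mem_MpPsi]
  refine and_congr ⟨fun hA h f => ?_, fun hA h' f => ?_⟩ Iff.rfl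
  · obtain ⟨h', rfl⟩ := hτs h
    have h1 := hA h' f
    rw [comp_apply_apply, comp_apply_apply, hτa g hg hg'] at h1
    exact h1
  · have h1 := hA (τ h') f
    rw [comp_apply_apply, comp_apply_apply, hτa g hg hg']
    exact h1

include hξ in
omit [NumberField F] in
/-- the ambient identification `Sp(½ξφ_𝐀) × GL(S) ≃ Sp(½φ_𝐀) × GL(S)` is the identity on the `Sp`-component, read in
`GL(W_𝐀)`. [cite: GelbartRogawski1991, §3.1 p. 454 L22–25] -/
theorem prodCongr_subgroupCongr_fst [NumberField F] (q : adelicSp F E V (ξ • Φ) × (S ≃ₗ[ℂ] S)) :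
    (((MulEquiv.prodCongr (MulEquiv.subgroupCongr (adelicSp_smul F E V Φ hξ)) (MulEquiv.refl (S ≃ₗ[ℂ] S))) q).1 :
        AdelicSpace F V ≃ₗ[AdeleRing (𝓞 F) F] AdelicSpace F V) = (q.1 : _) :=
  MulEquiv.subgroupCongr_apply (adelicSp_smul F E V Φ hξ) q.1

include hξ in
omit [NumberField F] in
/-- … and the identity on the operator component. [cite: GelbartRogawski1991, §3.1 p. 454 L22–25] -/
theorem prodCongr_subgroupCongr_snd [NumberField F] (q : adelicSp F E V (ξ • Φ) × (S ≃ₗ[ℂ] S)) :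
    ((MulEquiv.prodCongr (MulEquiv.subgroupCongr (adelicSp_smul F E V Φ hξ)) (MulEquiv.refl (S ≃ₗ[ℂ] S))) q).2 = q.2 := by
  -- kernel-safe: through `Equiv.prodCongr_apply` / `Prod.map_snd` (no structure-eta across the two products)
  show ((Equiv.prodCongr (MulEquiv.subgroupCongr (adelicSp_smul F E V Φ hξ)).toEquiv
    (MulEquiv.refl (S ≃ₗ[ℂ] S)).toEquiv) q).2 = q.2
  rw [Equiv.prodCongr_apply, Prod.map_snd]
  rfl

include hξ hτs hτa in
/-- the ambient identification carries `Mp_𝐀(W)_{ρ ∘ τ}` (data `(V, ξΦ)`) onto `Mp_𝐀(W)_ρ` (data `(V, Φ)`).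
[cite: GelbartRogawski1991, §3.1 p. 454 L21–24; MoeglinVignerasWaldspurger1987, Chap. 2 II.1 (A)] -/
theorem map_adelicMp_smul :
    (adelicMp F E V (ξ • Φ) (ρ.comp τ)).map
        (MulEquiv.prodCongr (MulEquiv.subgroupCongr (adelicSp_smul F E V Φ hξ)) (MulEquiv.refl (S ≃ₗ[ℂ] S))).toMonoidHom =
      adelicMp F E V Φ ρ := by
  refine Subgroup.ext fun q => ?_
  rw [Subgroup.mem_map_equiv]
  obtain ⟨⟨g, hg⟩, M⟩ := q
  have hg' : g ∈ adelicSp F E V (ξ • Φ) := by rw [adelicSp_smul F E V Φ hξ]; exact hg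
  have hq : (MulEquiv.prodCongr (MulEquiv.subgroupCongr (adelicSp_smul F E V Φ hξ)) (MulEquiv.refl (S ≃ₗ[ℂ] S))).symm
      (⟨g, hg⟩, M) = (⟨g, hg'⟩, M) := by
    rw [MulEquiv.symm_apply_eq]
    refine Prod.ext (Subtype.ext ?_) ?_
    · rw [prodCongr_subgroupCongr_fst hξ]
    · rw [prodCongr_subgroupCongr_snd hξ]
  rw [hq]
  exact mem_adelicMp_smul_iff τ hτs hτa ρ g hg hg' M

include hξ hτs hτa in
/-- **`Mp_𝐀(W)` over `ρ ∘ τ` (data `(V, ξΦ)`) and over `ρ` (data `(V, Φ)`) are identified by `(g, M) ↦ (g, M)`**: a group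
isomorphism over `Sp_𝐀(W)` (`projEnd` preserved) with the same operators (`op` preserved), bicontinuous for print's topology
(rendering R2). [cite: GelbartRogawski1991, §3.1 p. 454 L21–36; MoeglinVignerasWaldspurger1987, Chap. 2 II.1 (B)] -/
theorem exists_mulEquiv_adelicMp_smul :
    ∃ Ψ : adelicMp F E V (ξ • Φ) (ρ.comp τ) ≃* adelicMp F E V Φ ρ,
      Continuous Ψ ∧ Continuous Ψ.symm ∧
      (∀ p, projEnd F E V Φ ρ (Ψ p) = projEnd F E V (ξ • Φ) (ρ.comp τ) p) ∧
      (∀ p, op F E V Φ ρ (Ψ p) = op F E V (ξ • Φ) (ρ.comp τ) p) := by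
  let Θ : adelicSp F E V (ξ • Φ) × (S ≃ₗ[ℂ] S) ≃* adelicSp F E V Φ × (S ≃ₗ[ℂ] S) :=
    MulEquiv.prodCongr (MulEquiv.subgroupCongr (adelicSp_smul F E V Φ hξ)) (MulEquiv.refl (S ≃ₗ[ℂ] S))
  let Ψ : adelicMp F E V (ξ • Φ) (ρ.comp τ) ≃* adelicMp F E V Φ ρ :=
    (Θ.subgroupMap (adelicMp F E V (ξ • Φ) (ρ.comp τ))).trans
      (MulEquiv.subgroupCongr (map_adelicMp_smul hξ τ hτs hτa ρ))
  have hΨv : ∀ p, ((Ψ p : adelicMp F E V Φ ρ) : adelicSp F E V Φ × (S ≃ₗ[ℂ] S)) =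
      Θ (p : adelicSp F E V (ξ • Φ) × (S ≃ₗ[ℂ] S)) := fun p => by
    rw [MulEquiv.trans_apply, MulEquiv.subgroupCongr_apply, MulEquiv.coe_subgroupMap_apply]
  have hE : ∀ p, projEnd F E V Φ ρ (Ψ p) = projEnd F E V (ξ • Φ) (ρ.comp τ) p := fun p => by
    rw [projEnd_eq_coe, projEnd_eq_coe, hΨv, prodCongr_subgroupCongr_fst hξ]
  have hO : ∀ p, op F E V Φ ρ (Ψ p) = op F E V (ξ • Φ) (ρ.comp τ) p := fun p => by
    rw [op_eq_snd, op_eq_snd, hΨv, prodCongr_subgroupCongr_snd hξ]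
  have hE' : ∀ p, projEnd F E V (ξ • Φ) (ρ.comp τ) (Ψ.symm p) = projEnd F E V Φ ρ p := fun p => by
    rw [← hE, MulEquiv.apply_symm_apply]
  have hO' : ∀ p, op F E V (ξ • Φ) (ρ.comp τ) (Ψ.symm p) = op F E V Φ ρ p := fun p => by
    rw [← hO, MulEquiv.apply_symm_apply]
  refine ⟨Ψ, ?_, ?_, hE, hO⟩
  · refine continuous_to_adelicMp F E V Φ ρ (fun w => ?_) (fun f => ?_)
    · simp only [hE]
      exact continuous_projEnd_apply F E V (ξ • Φ) (ρ.comp τ) w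
    · simp only [hO]
      exact continuous_op_apply F E V (ξ • Φ) (ρ.comp τ) f
  · refine continuous_to_adelicMp F E V (ξ • Φ) (ρ.comp τ) (fun w => ?_) (fun f => ?_)
    · simp only [hE']
      exact continuous_projEnd_apply F E V Φ ρ w
    · simp only [hO']
      exact continuous_op_apply F E V Φ ρ f

end Mp

/-! ## §7 Transport of rational splittings and of the printed conclusion -/

section Transport

variable {F E V Φ}
variable {S : Type} [NormedAddCommGroup S] [InnerProductSpace ℂ S]
variable {τ : AdelicHeisenberg F E V (ξ • Φ) →* AdelicHeisenberg F E V Φ}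
variable {ρ : Representation ℂ (AdelicHeisenberg F E V Φ) S}
variable (Ψ : adelicMp F E V (ξ • Φ) (ρ.comp τ) ≃* adelicMp F E V Φ ρ)
  (hΨE : ∀ p, projEnd F E V Φ ρ (Ψ p) = projEnd F E V (ξ • Φ) (ρ.comp τ) p)

include hΨE in
/-- `Ψ⁻¹` also lies over `Sp_𝐀(W)`. [cite: GelbartRogawski1991, §3.1 p. 454 L25] -/
theorem projEnd_symm_of_projEnd (p : adelicMp F E V Φ ρ) :
    projEnd F E V (ξ • Φ) (ρ.comp τ) (Ψ.symm p) = projEnd F E V Φ ρ p := by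
  rw [← hΨE, MulEquiv.apply_symm_apply]

include hξ hΨE in
/-- **rational splittings go over**, `(V, ξΦ) → (V, Φ)`: `Ψ ∘ i' ∘ (Sp_F(W) = Sp_F(W))` is a rational splitting for
`(V, Φ, ρ)` if `i'` is one for `(V, ξΦ, ρ ∘ τ)`. [cite: GelbartRogawski1991, §3.1 p. 454 L35–36] -/
theorem isRationalSplitting_of_smul (i' : ratSp F E V (ξ • Φ) →* adelicMp F E V (ξ • Φ) (ρ.comp τ))
    (hi' : IsRationalSplitting F E V (ξ • Φ) (ρ.comp τ) i') :
    IsRationalSplitting F E V Φ ρ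
      (Ψ.toMonoidHom.comp (i'.comp (MulEquiv.subgroupCongr (ratSp_smul F E V Φ hξ).symm).toMonoidHom)) := by
  intro g₀
  simp only [MonoidHom.comp_apply, MulEquiv.coe_toMonoidHom]
  rw [hΨE, hi', MulEquiv.subgroupCongr_apply]

include hξ hΨE in
/-- **rational splittings go over**, `(V, Φ) → (V, ξΦ)`. [cite: GelbartRogawski1991, §3.1 p. 454 L35–36] -/
theorem isRationalSplitting_smul_of (i : ratSp F E V Φ →* adelicMp F E V Φ ρ) (hi : IsRationalSplitting F E V Φ ρ i) :
    IsRationalSplitting F E V (ξ • Φ) (ρ.comp τ)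
      (Ψ.symm.toMonoidHom.comp (i.comp (MulEquiv.subgroupCongr (ratSp_smul F E V Φ hξ)).toMonoidHom)) := by
  intro g₀
  simp only [MonoidHom.comp_apply, MulEquiv.coe_toMonoidHom]
  rw [projEnd_symm_of_projEnd Ψ hΨE, hi, MulEquiv.subgroupCongr_apply]

variable [Module E V] [IsScalarTower F E V]

include hξ in
/-- the identification `G(𝐀)` of `(V, Φ)` `=` `G(𝐀)` of `(V, ξΦ)` is continuous for the printed topologies (pointwise
convergence on `W_𝐀` on both sides). [cite: GelbartRogawski1991, Prop. 3.1.1 p. 455 L1–2] -/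
theorem continuous_subgroupCongr_adelicUnitary :
    Continuous (MulEquiv.subgroupCongr (adelicUnitary_smul F E V Φ hξ).symm) := by
  letI : TopologicalSpace (AdelicSpace F V) := adelicSpaceTopology F V
  refine continuous_iInf_rng.2 fun w => continuous_induced_rng.2 ?_
  have e1 : ((fun g : adelicUnitary F E V (ξ • Φ) => (g : AdelicSpace F V ≃ₗ[AdeleRing (𝓞 F) F] AdelicSpace F V) w) ∘
      (MulEquiv.subgroupCongr (adelicUnitary_smul F E V Φ hξ).symm)) =
        fun g : adelicUnitary F E V Φ => (g : AdelicSpace F V ≃ₗ[AdeleRing (𝓞 F) F] AdelicSpace F V) w := by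
    funext g
    rw [Function.comp_apply, MulEquiv.subgroupCongr_apply]
  rw [e1]
  exact continuous_iInf_dom (i := w) continuous_induced_dom

include hξ hΨE in
/-- **TRANSPORT OF THE PRINTED CONCLUSION `(V, ξΦ, ρ ∘ τ, i') ⟹ (V, Φ, ρ, Ψ ∘ i' ∘ =)`**: clauses (1) ∧ (2) of Prop. 3.1.1,
verbatim as rendered in `Prop311AsPrinted`, pass from the rescaled data to the original data along `Ψ` (continuous, over
`Sp_𝐀(W)`), the equality `G(𝐀) = G(𝐀)` (continuous, rational points to rational points) and `Sp_F(W) = Sp_F(W)`.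
[cite: GelbartRogawski1991, Prop. 3.1.1 p. 455 L1–2] -/
theorem conclusion_transport_smul (hΨc : Continuous Ψ)
    (i' : ratSp F E V (ξ • Φ) →* adelicMp F E V (ξ • Φ) (ρ.comp τ))
    (h' : (∃ s : adelicUnitary F E V (ξ • Φ) →* adelicMp F E V (ξ • Φ) (ρ.comp τ),
        ∀ g : adelicUnitary F E V (ξ • Φ), projEnd F E V (ξ • Φ) (ρ.comp τ) (s g) =
          ((g : AdelicSpace F V ≃ₗ[AdeleRing (𝓞 F) F] AdelicSpace F V) :
            AdelicSpace F V →ₗ[AdeleRing (𝓞 F) F] AdelicSpace F V)) ∧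
      ∃ s : adelicUnitary F E V (ξ • Φ) →* adelicMp F E V (ξ • Φ) (ρ.comp τ),
        Continuous s ∧
        (∀ g : adelicUnitary F E V (ξ • Φ), projEnd F E V (ξ • Φ) (ρ.comp τ) (s g) =
          ((g : AdelicSpace F V ≃ₗ[AdeleRing (𝓞 F) F] AdelicSpace F V) :
            AdelicSpace F V →ₗ[AdeleRing (𝓞 F) F] AdelicSpace F V)) ∧
        ∀ g : adelicUnitary F E V (ξ • Φ),
          IsRationalPoint F E V (ξ • Φ) (g : AdelicSpace F V ≃ₗ[AdeleRing (𝓞 F) F] AdelicSpace F V) →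
            s g ∈ i'.range) :
    (∃ s : adelicUnitary F E V Φ →* adelicMp F E V Φ ρ,
        ∀ g : adelicUnitary F E V Φ, projEnd F E V Φ ρ (s g) =
          ((g : AdelicSpace F V ≃ₗ[AdeleRing (𝓞 F) F] AdelicSpace F V) :
            AdelicSpace F V →ₗ[AdeleRing (𝓞 F) F] AdelicSpace F V)) ∧
      ∃ s : adelicUnitary F E V Φ →* adelicMp F E V Φ ρ,
        Continuous s ∧
        (∀ g : adelicUnitary F E V Φ, projEnd F E V Φ ρ (s g) =
          ((g : AdelicSpace F V ≃ₗ[AdeleRing (𝓞 F) F] AdelicSpace F V) :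
            AdelicSpace F V →ₗ[AdeleRing (𝓞 F) F] AdelicSpace F V)) ∧
        ∀ g : adelicUnitary F E V Φ,
          IsRationalPoint F E V Φ (g : AdelicSpace F V ≃ₗ[AdeleRing (𝓞 F) F] AdelicSpace F V) →
            s g ∈ (Ψ.toMonoidHom.comp (i'.comp
              (MulEquiv.subgroupCongr (ratSp_smul F E V Φ hξ).symm).toMonoidHom)).range := by
  obtain ⟨⟨s₁, hs₁⟩, s₂, hs₂c, hs₂, hs₂r⟩ := h'
  -- the identification of the unitary groups and its effect on the underlying automorphism of `W_𝐀`
  have hl : ∀ g : adelicUnitary F E V Φ,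
      ((MulEquiv.subgroupCongr (adelicUnitary_smul F E V Φ hξ).symm g : adelicUnitary F E V (ξ • Φ)) :
        AdelicSpace F V ≃ₗ[AdeleRing (𝓞 F) F] AdelicSpace F V) = (g : _) := fun g =>
    MulEquiv.subgroupCongr_apply _ g
  refine ⟨⟨Ψ.toMonoidHom.comp (s₁.comp (MulEquiv.subgroupCongr (adelicUnitary_smul F E V Φ hξ).symm).toMonoidHom),
    fun g => ?_⟩, Ψ.toMonoidHom.comp (s₂.comp (MulEquiv.subgroupCongr (adelicUnitary_smul F E V Φ hξ).symm).toMonoidHom),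
    ?_, fun g => ?_, fun g hg => ?_⟩
  · simp only [MonoidHom.comp_apply, MulEquiv.coe_toMonoidHom]
    rw [hΨE, hs₁, hl]
  · -- `simp only`, not `rw`: `rw`'s head-keyed abstraction would try to unify `⇑Ψ.toMonoidHom` with `⇑(?g.comp ?f)`
    simp only [MonoidHom.coe_comp, MulEquiv.coe_toMonoidHom]
    exact hΨc.comp (hs₂c.comp (continuous_subgroupCongr_adelicUnitary hξ))
  · simp only [MonoidHom.comp_apply, MulEquiv.coe_toMonoidHom]
    rw [hΨE, hs₂, hl]
  · have hg' : IsRationalPoint F E V (ξ • Φ)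
        ((MulEquiv.subgroupCongr (adelicUnitary_smul F E V Φ hξ).symm g : adelicUnitary F E V (ξ • Φ)) :
          AdelicSpace F V ≃ₗ[AdeleRing (𝓞 F) F] AdelicSpace F V) := by
      rw [hl, isRationalPoint_smul_iff F E V Φ hξ]
      exact hg
    obtain ⟨r, hr⟩ := MonoidHom.mem_range.1 (hs₂r _ hg')
    refine MonoidHom.mem_range.2 ⟨(MulEquiv.subgroupCongr (ratSp_smul F E V Φ hξ)) r, ?_⟩
    have hκ : (MulEquiv.subgroupCongr (ratSp_smul F E V Φ hξ).symm)
        ((MulEquiv.subgroupCongr (ratSp_smul F E V Φ hξ)) r) = r :=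
      Subtype.ext (by rw [MulEquiv.subgroupCongr_apply, MulEquiv.subgroupCongr_apply])
    have h2 : i' ((MulEquiv.subgroupCongr (ratSp_smul F E V Φ hξ).symm)
        ((MulEquiv.subgroupCongr (ratSp_smul F E V Φ hξ)) r)) =
        s₂ ((MulEquiv.subgroupCongr (adelicUnitary_smul F E V Φ hξ).symm) g) := by
      rw [hκ]
      exact hr
    simp only [MonoidHom.comp_apply, MulEquiv.coe_toMonoidHom]
    exact congrArg Ψ h2

end Transport

/-! ## §8 The reduction for the concrete `τ_ξ`: the printed conclusion for `(V, ξΦ, ρ ∘ τ_ξ)` gives it for `(V, Φ, ρ)` -/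

section Concrete

variable {F E V Φ}
variable [Module E V] [IsScalarTower F E V]
variable {S : Type} [NormedAddCommGroup S] [InnerProductSpace ℂ S]
variable (ρ : Representation ℂ (AdelicHeisenberg F E V Φ) S)

include hξ in
/-- **THE REDUCTION.**  Let `(V, Φ)` be printed data over `E/F`, `ξ ∈ Fˣ`, `ρ` a printed model (unitary, irreducible) for
`(V, Φ)` with THE rational splitting `i` (binders `_hρu _hρi i _hi` of `Prop311AsPrinted`; `σ`, skewness and non-degeneracy
only feed the uniqueness of `i`).  If clauses (1) ∧ (2) of [GelbartRogawski1991, Prop. 3.1.1] hold, verbatim as rendered in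
`Prop311AsPrinted`, for the rescaled data `(V, ξΦ)`, the model `ρ ∘ τ_ξ` and SOME rational splitting `i'` of it, then they hold
for `(V, Φ)`, `ρ` and `i`. [cite: GelbartRogawski1991, Prop. 3.1.1 p. 455 L1–2; §3.1 p. 454 L17–42] -/
theorem conclusion_of_conclusion_smul [Algebra.IsQuadraticExtension F E] [FiniteDimensional E V] [CompleteSpace S]
    (σ : E ≃ₐ[F] E)
    (hΦ₃ : ∀ x y : V, Φ y x = -σ (Φ x y)) (hφ : (traceForm F E V Φ).Nondegenerate)
    (hρu : ∀ (h : AdelicHeisenberg F E V Φ) (f : S), ‖ρ h f‖ = ‖f‖)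
    (hρi : ∀ K : Submodule ℂ S, IsClosed (K : Set S) →
      (∀ (h : AdelicHeisenberg F E V Φ), ∀ f ∈ K, ρ h f ∈ K) → K = ⊥ ∨ K = ⊤)
    (i : ratSp F E V Φ →* adelicMp F E V Φ ρ) (hi : IsRationalSplitting F E V Φ ρ i)
    (i' : ratSp F E V (ξ • Φ) →* adelicMp F E V (ξ • Φ)
      (ρ.comp (Heisenberg.map (heisForm F E V Φ) (AddMonoidHom.id _)
        (AddMonoidHom.mulLeft (algebraMap F (AdeleRing (𝓞 F) F) ξ⁻¹)) (heisTwist_compat F E V Φ hξ))))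
    (hi' : IsRationalSplitting F E V (ξ • Φ) _ i')
    (h' : (∃ s : adelicUnitary F E V (ξ • Φ) →* adelicMp F E V (ξ • Φ)
          (ρ.comp (Heisenberg.map (heisForm F E V Φ) (AddMonoidHom.id _)
            (AddMonoidHom.mulLeft (algebraMap F (AdeleRing (𝓞 F) F) ξ⁻¹)) (heisTwist_compat F E V Φ hξ))),
        ∀ g : adelicUnitary F E V (ξ • Φ), projEnd F E V (ξ • Φ) _ (s g) =
          ((g : AdelicSpace F V ≃ₗ[AdeleRing (𝓞 F) F] AdelicSpace F V) :
            AdelicSpace F V →ₗ[AdeleRing (𝓞 F) F] AdelicSpace F V)) ∧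
      ∃ s : adelicUnitary F E V (ξ • Φ) →* adelicMp F E V (ξ • Φ)
          (ρ.comp (Heisenberg.map (heisForm F E V Φ) (AddMonoidHom.id _)
            (AddMonoidHom.mulLeft (algebraMap F (AdeleRing (𝓞 F) F) ξ⁻¹)) (heisTwist_compat F E V Φ hξ))),
        Continuous s ∧
        (∀ g : adelicUnitary F E V (ξ • Φ), projEnd F E V (ξ • Φ) _ (s g) =
          ((g : AdelicSpace F V ≃ₗ[AdeleRing (𝓞 F) F] AdelicSpace F V) :
            AdelicSpace F V →ₗ[AdeleRing (𝓞 F) F] AdelicSpace F V)) ∧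
        ∀ g : adelicUnitary F E V (ξ • Φ),
          IsRationalPoint F E V (ξ • Φ) (g : AdelicSpace F V ≃ₗ[AdeleRing (𝓞 F) F] AdelicSpace F V) →
            s g ∈ i'.range) :
    (∃ s : adelicUnitary F E V Φ →* adelicMp F E V Φ ρ,
        ∀ g : adelicUnitary F E V Φ, projEnd F E V Φ ρ (s g) =
          ((g : AdelicSpace F V ≃ₗ[AdeleRing (𝓞 F) F] AdelicSpace F V) :
            AdelicSpace F V →ₗ[AdeleRing (𝓞 F) F] AdelicSpace F V)) ∧
      ∃ s : adelicUnitary F E V Φ →* adelicMp F E V Φ ρ,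
        Continuous s ∧
        (∀ g : adelicUnitary F E V Φ, projEnd F E V Φ ρ (s g) =
          ((g : AdelicSpace F V ≃ₗ[AdeleRing (𝓞 F) F] AdelicSpace F V) :
            AdelicSpace F V →ₗ[AdeleRing (𝓞 F) F] AdelicSpace F V)) ∧
        ∀ g : adelicUnitary F E V Φ,
          IsRationalPoint F E V Φ (g : AdelicSpace F V ≃ₗ[AdeleRing (𝓞 F) F] AdelicSpace F V) → s g ∈ i.range := by
  haveI : FiniteDimensional F V := finite_restrictScalars F E V
  obtain ⟨Ψ, hΨc, -, hΨE, -⟩ := exists_mulEquiv_adelicMp_smul hξ _ (heisTwist_surjective F E V Φ hξ)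
    (heisTwist_act F E V Φ hξ) ρ
  have hj := isRationalSplitting_of_smul hξ Ψ hΨE i' hi'
  have hji : Ψ.toMonoidHom.comp (i'.comp (MulEquiv.subgroupCongr (ratSp_smul F E V Φ hξ).symm).toMonoidHom) = i :=
    rationalSplitting_unique F E V Φ ρ σ hΦ₃ hφ hρu hρi i _ hi hj
  rw [← hji]
  exact conclusion_transport_smul hξ Ψ hΨE hΨc i' h'

include hξ in
omit [Module E V] [IsScalarTower F E V] in
/-- **a rational splitting for the rescaled model from one for the original model** (the binder `_hi` of
`Prop311AsPrinted` for `(V, ξΦ, ρ ∘ τ_ξ)`). [cite: GelbartRogawski1991, §3.1 p. 454 L35–36] -/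
theorem exists_isRationalSplitting_smul (i : ratSp F E V Φ →* adelicMp F E V Φ ρ) (hi : IsRationalSplitting F E V Φ ρ i) :
    ∃ i' : ratSp F E V (ξ • Φ) →* adelicMp F E V (ξ • Φ)
      (ρ.comp (Heisenberg.map (heisForm F E V Φ) (AddMonoidHom.id _)
        (AddMonoidHom.mulLeft (algebraMap F (AdeleRing (𝓞 F) F) ξ⁻¹)) (heisTwist_compat F E V Φ hξ))),
      IsRationalSplitting F E V (ξ • Φ) _ i' := by
  obtain ⟨Ψ, -, -, hΨE, -⟩ := exists_mulEquiv_adelicMp_smul hξ _ (heisTwist_surjective F E V Φ hξ)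
    (heisTwist_act F E V Φ hξ) ρ
  exact ⟨_, isRationalSplitting_smul_of hξ Ψ hΨE i hi⟩

end Concrete

end Prop311

end Literature.NumberTheory.GelbartRogawski1991

end
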